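import Mathlib.Data.Matrix.Basic
import Mathlib.Data.Matrix.Block
import Mathlib.LinearAlgebra.Matrix.Trace
import Mathlib.Tactic
import HarnessLib

/-!
# The trace table of `ℤ[ζ₈]` and the integrality kill of CC note §26.8 (T13)

Kernel leaf for the W1 twisted squad (cell `pub-hsemireg`, seat w1-tw-2 gen 13), recording the arithmetic core of
w1-tw-1's THEOREM (T13) (`ENDO-INTEGRALITY-w1tw1.md` §2 (TR) and §4 STEP 4), read ×2 in `PSTU-READ-tw2.md` §24.
Throughout, `M` is the companion matrix of `X⁴ + 1` — multiplication by `ζ₈` on `ℤ[ζ₈] ≅ ℤ⁴` in the basis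
`1, ζ, ζ², ζ³` — introduced by the hypothesis `hM` (so that this leaf declares theorems only):

* `M ^ 4 = -1`, `M ^ 8 = 1`;
* the trace table `tr (M ^ m) = 4, 0, 0, 0, -4, 0, 0, 0` (`m mod 8`), which is the Lefschetz table `12, 0, 0, 0, -12, 0, 0, 0`
  of `⟨σ⟩` on `H¹(C, ℚ) ≅ ℚ(ζ₈)³` divided by the rank `3`;
* for an INTEGER polynomial `γ = c₀ + c₁ζ + c₂ζ² + c₃ζ³` one has `tr (ζ^{-k} γ) = 4·c_k` (`k = 0,…,3`; here `ζ^{-k} = ζ^{8-k}`),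
  and on `r` copies (block diagonal) `r·4·c_k`;
* INTEGRALITY KILL: if `|tr| ≤ 3r < 4r` for every `k` then every `c_k = 0`, i.e. `γ = 0` — with `r = 3` this is
  «`12|c_k| ≤ a₁ + d₁ ≤ 9 ⇒ γ₁ = 0`» of (T13) STEP 4.

Honest framing: linear algebra over `ℤ` (theorems only); the geometric inputs of (T13) (Hurwitz's trace formula,
the bidegree bound `a(T) ≤ 12`) are not formalised here; nothing here bears on HC / HC_CM / HC_AV.
-/

namespace Summit.Ventures.HSemireg.EndomorphismIntegralityTrace

open Matrix

/-- `ζ₈⁴ = -1`: the companion matrix of `X⁴ + 1` has `M ^ 4 = -1`. -/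
theorem M_pow_four (M : Matrix (Fin 4) (Fin 4) ℤ) (hM : M = !![0, 0, 0, -1; 1, 0, 0, 0; 0, 1, 0, 0; 0, 0, 1, 0]) :
    M ^ 4 = -1 := by
  subst hM; decide

/-- `ζ₈⁸ = 1`. -/
theorem M_pow_eight (M : Matrix (Fin 4) (Fin 4) ℤ) (hM : M = !![0, 0, 0, -1; 1, 0, 0, 0; 0, 1, 0, 0; 0, 0, 1, 0]) :
    M ^ 8 = 1 := by
  rw [show (8 : ℕ) = 4 + 4 from rfl, pow_add, M_pow_four M hM]; simp

/-- The trace table of `ζ₈^m` on `ℤ[ζ₈]`, `m = 0, …, 11`: `4, 0, 0, 0, -4, 0, 0, 0, 4, 0, 0, 0`. -/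
theorem trace_M_pow_table (M : Matrix (Fin 4) (Fin 4) ℤ)
    (hM : M = !![0, 0, 0, -1; 1, 0, 0, 0; 0, 1, 0, 0; 0, 0, 1, 0]) :
    (M ^ 0).trace = 4 ∧ (M ^ 1).trace = 0 ∧ (M ^ 2).trace = 0 ∧ (M ^ 3).trace = 0 ∧ (M ^ 4).trace = -4 ∧
    (M ^ 5).trace = 0 ∧ (M ^ 6).trace = 0 ∧ (M ^ 7).trace = 0 ∧ (M ^ 8).trace = 4 ∧ (M ^ 9).trace = 0 ∧
    (M ^ 10).trace = 0 ∧ (M ^ 11).trace = 0 := by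
  subst hM; decide

/-- The trace of `ζ₈^m` only depends on `m mod 8`. -/
theorem trace_M_pow_mod (M : Matrix (Fin 4) (Fin 4) ℤ)
    (hM : M = !![0, 0, 0, -1; 1, 0, 0, 0; 0, 1, 0, 0; 0, 0, 1, 0]) (m : ℕ) :
    (M ^ m).trace = (M ^ (m % 8)).trace := by
  conv_lhs => rw [← Nat.mod_add_div m 8, pow_add, pow_mul, M_pow_eight M hM, one_pow, mul_one]

/-- The trace table for every exponent: `tr (ζ₈^m) = 4` if `8 ∣ m`, `-4` if `m ≡ 4 (mod 8)`, `0` otherwise. -/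
theorem trace_M_pow (M : Matrix (Fin 4) (Fin 4) ℤ)
    (hM : M = !![0, 0, 0, -1; 1, 0, 0, 0; 0, 1, 0, 0; 0, 0, 1, 0]) (m : ℕ) :
    (M ^ m).trace = if m % 8 = 0 then 4 else if m % 8 = 4 then -4 else 0 := by
  rw [trace_M_pow_mod M hM]
  have h := Nat.mod_lt m (by norm_num : 0 < 8)
  obtain ⟨t0, t1, t2, t3, t4, t5, t6, t7, -⟩ := trace_M_pow_table M hM
  interval_cases hm : m % 8 <;> simp_all

/-- (TR), rank one: for the integer polynomial `γ = Σ c_j ζ^j`, `tr (ζ^{-k} · γ) = 4·c_k` for `k = 0, …, 3`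
(with `ζ^{-k} = ζ^{8-k}`). -/
theorem trace_shift_gamma (M : Matrix (Fin 4) (Fin 4) ℤ)
    (hM : M = !![0, 0, 0, -1; 1, 0, 0, 0; 0, 1, 0, 0; 0, 0, 1, 0]) (c : Fin 4 → ℤ) (k : Fin 4) :
    (M ^ (8 - (k : ℕ)) * ∑ j : Fin 4, c j • M ^ (j : ℕ)).trace = 4 * c k := by
  rw [Finset.mul_sum, trace_sum]
  simp_rw [Matrix.mul_smul, ← pow_add, trace_smul, smul_eq_mul]
  fin_cases k <;> simp [Fin.sum_univ_four, trace_M_pow M hM] <;> ring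

/-- (TR), rank `r`: on `r` copies of `ℤ[ζ₈]` (block diagonal) the trace of `ζ^{-k} γ` is `r · 4 · c_k`
(for (T13): `r = 3`, `H₁(J, ℚ) ≅ ℚ(ζ₈)³`, trace `12·c_k`). -/
theorem trace_shift_gamma_copies (M : Matrix (Fin 4) (Fin 4) ℤ)
    (hM : M = !![0, 0, 0, -1; 1, 0, 0, 0; 0, 1, 0, 0; 0, 0, 1, 0]) (r : ℕ) (c : Fin 4 → ℤ) (k : Fin 4) :
    (blockDiagonal fun _ : Fin r => M ^ (8 - (k : ℕ)) * ∑ j : Fin 4, c j • M ^ (j : ℕ)).trace =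
      (r : ℤ) * (4 * c k) := by
  rw [trace_blockDiagonal, Finset.sum_const, Finset.card_univ, Fintype.card_fin, trace_shift_gamma M hM,
    nsmul_eq_mul]

/-- INTEGRALITY KILL, rank `r`: if on `r ≥ 1` copies every shifted trace is bounded by `3r` in absolute value
(any bound `< 4r` would do), then every coefficient `c_k` vanishes. For (T13): `r = 3`, bound `a₁ + d₁ ≤ 9`. -/
theorem coeff_eq_zero_of_trace_bound (M : Matrix (Fin 4) (Fin 4) ℤ)
    (hM : M = !![0, 0, 0, -1; 1, 0, 0, 0; 0, 1, 0, 0; 0, 0, 1, 0]) (r : ℕ) (hr : 0 < r) (c : Fin 4 → ℤ)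
    (h : ∀ k : Fin 4,
      |(blockDiagonal fun _ : Fin r => M ^ (8 - (k : ℕ)) * ∑ j : Fin 4, c j • M ^ (j : ℕ)).trace| ≤ 3 * (r : ℤ)) :
    c = 0 := by
  funext k
  have hk := h k
  rw [trace_shift_gamma_copies M hM, abs_mul, Nat.abs_cast, abs_mul] at hk
  have hr' : (0 : ℤ) < r := by exact_mod_cast hr
  have h4 : (4 : ℤ) * |c k| ≤ 3 := by
    have habs : (|4| : ℤ) = 4 := by norm_num
    rw [habs] at hk
    nlinarith [abs_nonneg (c k)]
  have h0 : |c k| ≤ 0 := by omega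
  simpa using abs_nonpos_iff.mp h0

/-- The (T13) instance: on `H₁(J, ℚ) ≅ ℚ(ζ₈)³` (`r = 3`), `|tr(σ^{-k} γ₁)| ≤ 9` for `k = 0, …, 3` forces the integer
polynomial `γ₁ = c₀ + c₁σ + c₂σ² + c₃σ³` to vanish. -/
theorem gamma_eq_zero_rank_three (M : Matrix (Fin 4) (Fin 4) ℤ)
    (hM : M = !![0, 0, 0, -1; 1, 0, 0, 0; 0, 1, 0, 0; 0, 0, 1, 0]) (c : Fin 4 → ℤ)
    (h : ∀ k : Fin 4,
      |(blockDiagonal fun _ : Fin 3 => M ^ (8 - (k : ℕ)) * ∑ j : Fin 4, c j • M ^ (j : ℕ)).trace| ≤ 9) :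
    (∑ j : Fin 4, c j • M ^ (j : ℕ)) = 0 := by
  have hc : c = 0 := coeff_eq_zero_of_trace_bound M hM 3 (by norm_num) c (by simpa using h)
  subst hc
  simp

end Summit.Ventures.HSemireg.EndomorphismIntegralityTrace
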